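import Literature.AlgebraicGeometry.CossartPiltant200819.Rem41GenericFibreDimension2019
import HarnessLib

/-!
# Dimension of a scheme of finite type over a Noetherian domain from its generic fibre

Topic: `Literature/AlgebraicGeometry/Dimension` (Matsumura, *Commutative Ring Theory*, Thm. 15.5, the
dimension inequality `ht P ≤ ht (P ∩ A) + tr.deg_A B − tr.deg_{κ(P ∩ A)} κ(P)`; EGA IV₂ (5.6.5.1),
(2.3.4)). The tree's `CP2019.topologicalKrullDim_le_of_genericFibre_of_isMax`
(`CossartPiltant200819/Rem41GenericFibreDimension2019.lean`) bounds the dimension of a scheme `𝒴` locally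
of finite type over a DEDEKIND domain `𝒪` by `dim (generic fibre) + 1`. This module is the same argument
over an arbitrary Noetherian domain `𝒪` of Krull dimension `≤ d` — the form needed to spread out a
variety over a finitely generated field extension `K ⊇ k` of transcendence degree `d` to a model over a
finitely generated `k`-subalgebra `R ⊆ K` with `Frac R = K` and to control the dimension of the model
(`Literature/AlgebraicGeometry/Resolution/ResolutionFgExtensionTransfer.lean`):

* `topologicalKrullDim_le_of_genericFibre_of_isMax_of_ringKrullDim_le` — **`dim 𝒴 ≤ n + d`** for `𝒴`
  locally of finite type over a Noetherian domain `𝒪` with `dim 𝒪 ≤ d`, `j : T → 𝒴` affine over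
  `Spec F → Spec 𝒪` (`F = Frac 𝒪`) with `T` locally of finite type over `F` of dimension `≤ n`, provided
  every maximal point of `𝒴` is in the image of `j` (proof word for word that of the Dedekind case, with
  `ht (𝔭_y ∩ 𝒪) ≤ dim 𝒪 ≤ d` in place of `≤ 1`; the ring-level inequality is the tree's
  `CP2019.height_le_height_under_add_of_trdeg_minimalPrimes`);
* `topologicalKrullDim_le_of_isPullback_genericFibre_of_ringKrullDim_le` — the same for a cartesian
  square `𝒴 ×_𝒪 F = S` with `𝒴 → Spec 𝒪` FLAT (flat ⇒ generising, so maximal points lie on the generic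
  fibre);
* `topologicalKrullDim_le_of_isPullback_genericFibre_of_irreducibleSpace` — the same for a cartesian
  square with `𝒴` IRREDUCIBLE and non-empty generic fibre `S` (no flatness: the unique maximal point of `𝒴`
  is its generic point, which is the image of the generic point of any point of `S` — `j` is dominant,
  being the base change of the dominant `Spec F → Spec 𝒪` restricted to an irreducible target whose
  generic point lies over the generic point of `Spec 𝒪`).

Everything here is elementary commutative algebra and bookkeeping; adapted from the Dedekind-base file
named above. [folklore]

## References

* [Matsumura1987] H. Matsumura, *Commutative Ring Theory*, CUP 1987, Thm. 15.5, Thm. 5.6.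
* [EGAIV2] A. Grothendieck, J. Dieudonné, EGA IV₂, Publ. Math. IHÉS 24 (1965), (2.3.4), (5.6.5.1).
-/

noncomputable section

open CategoryTheory CategoryTheory.Limits AlgebraicGeometry TopologicalSpace Order

namespace Literature.AlgebraicGeometry.Dimension

open Literature.AlgebraicGeometry.Resolution Literature.AlgebraicGeometry.Motives
open Literature.AlgebraicGeometry.CossartPiltant200819

universe u

/-- **Dimension of a model over a Noetherian domain of dimension `≤ d` from its generic fibre**:
`𝒴` locally of finite type over the Noetherian domain `𝒪` with `dim 𝒪 ≤ d`, `j : T → 𝒴` affine with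
`j ≫ (𝒴 → Spec 𝒪) = (T → Spec F) ≫ (Spec F → Spec 𝒪)`, `T` locally of finite type over `F = Frac 𝒪` with
`dim T ≤ n`, and every maximal point of `𝒴` (generic point of an irreducible component) in the image of
`j`. Then `dim 𝒴 ≤ n + d`. Proof: for `y ∈ 𝒴` in an affine open `U = Spec C`,
`codim y = ht 𝔭_y ≤ ht (𝔭_y ∩ 𝒪) + n ≤ d + n` by `CP2019.height_le_height_under_add_of_trdeg_minimalPrimes`:
a minimal prime `Q' ⊆ 𝔭_y` of `C` is a maximal point `ξ = j(σ)` of `𝒴`, `σ ∈ V = j⁻¹U = Spec C'`, and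
`Q' = 𝔭_σ ∩ C`, so `C/Q' ↪ C'/𝔭_σ`, a domain of finite type over `F` with `dim C'/𝔭_σ ≤ dim T ≤ n`; hence
`Q' ∩ 𝒪 = 0` and `tr.deg_𝒪 C/Q' ≤ tr.deg_F C'/𝔭_σ = dim C'/𝔭_σ ≤ n` (Matsumura Thm. 5.6).
[cite: Matsumura1987, Thm. 15.5, Thm. 5.6] -/
theorem topologicalKrullDim_le_of_genericFibre_of_isMax_of_ringKrullDim_le
    {O F : Type u} [CommRing O] [IsDomain O] [IsNoetherianRing O] [Field F] [Algebra O F]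
    [IsFractionRing O F] {d : ℕ} (hO : ringKrullDim O ≤ d)
    {Y T : Scheme.{u}} (f : Y ⟶ Spec (.of O)) [LocallyOfFiniteType f]
    (a : T ⟶ Spec (.of F)) [LocallyOfFiniteType a] (j : T ⟶ Y) [IsAffineHom j]
    (hsq : j ≫ f = a ≫ Spec.map (CommRingCat.ofHom (algebraMap O F)))
    (hmax : ∀ ξ : Y, IsMax ξ → ∃ σ : T, j σ = ξ)
    {n : ℕ} (hT : topologicalKrullDim T ≤ n) : topologicalKrullDim Y ≤ (n + d : ℕ) := by
  -- adapted from CossartPiltant200819/Rem41GenericFibreDimension2019.lean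
  -- (`CP2019.topologicalKrullDim_le_of_genericFibre_of_isMax`, the Dedekind case `d = 1`)
  classical
  set i : Spec (.of F) ⟶ Spec (.of O) := Spec.map (CommRingCat.ofHom (algebraMap O F)) with hi
  rw [topologicalKrullDim_le_iff_forall_coheight_le]
  intro y
  -- an affine open `U = Spec C ∋ y`
  obtain ⟨_, ⟨U, hU, rfl⟩, hyU, -⟩ :=
    Y.isBasis_affineOpens.exists_subset_of_mem_open (Set.mem_univ y) isOpen_univ
  have hU : IsAffineOpen U := hU
  -- `codim y = ht 𝔭_y`
  set P : Spec Γ(Y, U) := hU.isoSpec.hom ⟨y, hyU⟩ with hP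
  have hco : coheight y = P.asIdeal.height := by
    have h1 := coheight_eq_of_isOpenImmersion (U := U) (X := Y) (x := ⟨y, hyU⟩) (Scheme.Opens.ι U)
    have h2 := coheight_eq_of_isOpenImmersion (U := U) (X := Spec Γ(Y, U)) (x := ⟨y, hyU⟩)
      hU.isoSpec.hom
    rw [idealHeight_eq_coheight, hP, h2, ← h1]
    rfl
  -- `C = Γ(Y, U)` as a finitely generated `𝒪`-algebra
  let eO : O ≃+* Γ(Spec (.of O), ⊤) := (Scheme.ΓSpecIso (.of O)).symm.commRingCatIsoToRingEquiv
  let φ : O →+* Γ(Y, U) := (f.appLE ⊤ U le_top).hom.comp eO.toRingHom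
  letI algOC : Algebra O Γ(Y, U) := φ.toAlgebra
  haveI : Algebra.FiniteType O Γ(Y, U) := by
    have h1 : (f.appLE ⊤ U le_top).hom.FiniteType :=
      f.finiteType_appLE (isAffineOpen_top _) hU le_top
    have h2 : eO.toRingHom.FiniteType := RingHom.FiniteType.of_surjective _ eO.surjective
    exact h1.comp h2
  haveI : IsNoetherianRing Γ(Y, U) := Algebra.FiniteType.isNoetherianRing O Γ(Y, U)
  -- `V = j⁻¹ U = Spec C'`, `ψ : C → C'`, `χ : F → C'`, and the tower `𝒪 → F → C'`
  set V : T.Opens := j ⁻¹ᵁ U with hV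
  have hVaff : IsAffineOpen V := hU.preimage j
  let ψ : Γ(Y, U) →+* Γ(T, V) := (j.appLE U V le_rfl).hom
  letI algOC' : Algebra O Γ(T, V) := (ψ.comp φ).toAlgebra
  letI algCC' : Algebra Γ(Y, U) Γ(T, V) := ψ.toAlgebra
  haveI : IsScalarTower O Γ(Y, U) Γ(T, V) := IsScalarTower.of_algebraMap_eq fun _ => rfl
  let eF : F ≃+* Γ(Spec (.of F), ⊤) := (Scheme.ΓSpecIso (.of F)).symm.commRingCatIsoToRingEquiv
  let χ : F →+* Γ(T, V) := (a.appLE ⊤ V le_top).hom.comp eF.toRingHom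
  letI algFC' : Algebra F Γ(T, V) := χ.toAlgebra
  haveI : Algebra.FiniteType F Γ(T, V) := by
    have h1 : (a.appLE ⊤ V le_top).hom.FiniteType :=
      a.finiteType_appLE (isAffineOpen_top _) hVaff le_top
    have h2 : eF.toRingHom.FiniteType := RingHom.FiniteType.of_surjective _ eF.surjective
    exact h1.comp h2
  have hcomm : (Scheme.ΓSpecIso (.of O)).inv ≫ f.appLE ⊤ U le_top ≫ j.appLE U V le_rfl =
      CommRingCat.ofHom (algebraMap O F) ≫ (Scheme.ΓSpecIso (.of F)).inv ≫ a.appLE ⊤ V le_top := by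
    have h1 : f.appLE ⊤ U le_top ≫ j.appLE U V le_rfl = (j ≫ f).appLE ⊤ V le_top := by
      rw [Scheme.Hom.appLE_comp_appLE]
    have h2 : (j ≫ f).appLE ⊤ V le_top = (a ≫ i).appLE ⊤ V le_top := by rw [hsq]
    have h3 : (a ≫ i).appLE ⊤ V le_top = i.appTop ≫ a.appLE ⊤ V le_top := by
      show _ = i.app ⊤ ≫ a.appLE ⊤ V le_top
      simp only [Scheme.Hom.appLE, Scheme.Hom.comp_app]
      rfl
    rw [h1, h2, h3, hi, ← Scheme.ΓSpecIso_inv_naturality_assoc]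
  haveI : IsScalarTower O F Γ(T, V) := by
    refine IsScalarTower.of_algebraMap_eq fun r => ?_
    exact congrArg (fun t => t.hom r) hcomm
  have htower : ψ.comp φ = χ.comp (algebraMap O F) := IsScalarTower.algebraMap_eq O F Γ(T, V)
  haveI : Algebra.IsAlgebraic O F := IsLocalization.isAlgebraic F (nonZeroDivisors O)
  -- `dim C' ≤ dim T ≤ n`
  have hdimV : ringKrullDim Γ(T, V) ≤ n := by
    rw [← PrimeSpectrum.topologicalKrullDim_eq_ringKrullDim]
    have h1 : topologicalKrullDim (PrimeSpectrum Γ(T, V)) ≤ topologicalKrullDim V :=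
      (Scheme.homeoOfIso hVaff.isoSpec).symm.isInducing.topologicalKrullDim_le
    have h2 : topologicalKrullDim V ≤ topologicalKrullDim T :=
      topologicalKrullDim_subspace_le T (V : Set T)
    exact h1.trans (h2.trans hT)
  -- `ht (𝔭_y ∩ 𝒪) ≤ dim 𝒪 ≤ d`
  have hhtd : (P.asIdeal.under O).height ≤ d := by
    have h := (Ideal.height_le_ringKrullDim_of_isPrime (I := P.asIdeal.under O)).trans hO
    exact_mod_cast h
  -- the minimal primes below `𝔭_y`
  have key : ∀ Q' : Ideal Γ(Y, U), Q' ∈ minimalPrimes Γ(Y, U) → Q' ≤ P.asIdeal →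
      Q'.under O = ⊥ ∧ Cardinal.toNat (Algebra.trdeg O (Γ(Y, U) ⧸ Q')) ≤ n := by
    intro Q' hQ' _hQ'P
    haveI hQ'prime : Q'.IsPrime := hQ'.1.1
    let q : Spec Γ(Y, U) := ⟨Q', hQ'prime⟩
    -- `ξ`, the point of `Q'`, is a maximal point of `Y`, hence `ξ = j σ`
    have hξmax : IsMax (hU.fromSpec q) := isMax_fromSpec_of_mem_minimalPrimes hU q hQ'
    obtain ⟨σ, hσ⟩ := hmax _ hξmax
    have hξU : hU.fromSpec q ∈ (U : Set Y) := by
      rw [← hU.range_fromSpec]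
      exact ⟨q, rfl⟩
    have hσV : σ ∈ V := by
      show j σ ∈ U
      rw [hσ]
      exact hξU
    set qσ : Spec Γ(T, V) := hVaff.primeIdealOf ⟨σ, hσV⟩ with hqσ
    -- `Q' = 𝔭_σ ∩ C`
    have hSpec : Spec.map (j.appLE U V le_rfl) qσ = q := by
      apply hU.fromSpec.isOpenEmbedding.injective
      have h1 : hU.fromSpec (Spec.map (j.appLE U V le_rfl) qσ) = j (hVaff.fromSpec qσ) := by
        rw [← Scheme.Hom.comp_apply, IsAffineOpen.SpecMap_appLE_fromSpec j hU hVaff,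
          Scheme.Hom.comp_apply]
      rw [h1, hqσ, IsAffineOpen.fromSpec_primeIdealOf, hσ]
    have hQ'eq : Q' = Ideal.comap ψ qσ.asIdeal := by
      have h := congrArg PrimeSpectrum.asIdeal hSpec
      rw [Spec.map_apply] at h
      exact h.symm
    -- the domain `D = C'/𝔭_σ`, of finite type over `F`, `dim D ≤ n`
    haveI : IsDomain (Γ(T, V) ⧸ qσ.asIdeal) := Ideal.Quotient.isDomain qσ.asIdeal
    haveI : Algebra.FiniteType F (Γ(T, V) ⧸ qσ.asIdeal) :=
      (inferInstance : Algebra.FiniteType F Γ(T, V)).of_surjective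
        (Ideal.Quotient.mkₐ F qσ.asIdeal) (Ideal.Quotient.mkₐ_surjective F qσ.asIdeal)
    haveI : FaithfulSMul F (Γ(T, V) ⧸ qσ.asIdeal) :=
      (faithfulSMul_iff_algebraMap_injective _ _).mpr
        (algebraMap F (Γ(T, V) ⧸ qσ.asIdeal)).injective
    have hdimD : (Cardinal.toNat (Algebra.trdeg F (Γ(T, V) ⧸ qσ.asIdeal)) : WithBot ℕ∞) ≤ n := by
      rw [← Literature.RingTheory.KrullDimension.ringKrullDim_eq_trdeg F (Γ(T, V) ⧸ qσ.asIdeal)]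
      exact (ringKrullDim_quotient_le _).trans hdimV
    -- `C/Q' ↪ D` over `𝒪`
    let ψa : Γ(Y, U) →ₐ[O] Γ(T, V) := IsScalarTower.toAlgHom O Γ(Y, U) Γ(T, V)
    have hψa : ∀ c, ψa c = ψ c := fun _ => rfl
    have hle : Q' ≤ Ideal.comap ψa qσ.asIdeal := by
      intro c hc
      rw [hQ'eq] at hc
      exact Ideal.mem_comap.mpr (by rw [hψa]; exact Ideal.mem_comap.mp hc)
    let θ : (Γ(Y, U) ⧸ Q') →ₐ[O] (Γ(T, V) ⧸ qσ.asIdeal) := Ideal.quotientMapₐ qσ.asIdeal ψa hle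
    have hθinj : Function.Injective θ := by
      rw [injective_iff_map_eq_zero]
      intro c hc
      obtain ⟨c, rfl⟩ := Ideal.Quotient.mk_surjective c
      have h1 : θ (Ideal.Quotient.mk Q' c) = Ideal.Quotient.mk qσ.asIdeal (ψ c) := rfl
      rw [h1, Ideal.Quotient.eq_zero_iff_mem] at hc
      rw [Ideal.Quotient.eq_zero_iff_mem, hQ'eq]
      exact Ideal.mem_comap.mpr hc
    have htr1 : Algebra.trdeg O (Γ(Y, U) ⧸ Q') ≤ Algebra.trdeg O (Γ(T, V) ⧸ qσ.asIdeal) :=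
      trdeg_le_of_injective θ hθinj
    have htr2 : Algebra.trdeg O (Γ(T, V) ⧸ qσ.asIdeal) =
        Algebra.trdeg F (Γ(T, V) ⧸ qσ.asIdeal) := by
      rw [← trdeg_add_eq O F (A := Γ(T, V) ⧸ qσ.asIdeal),
        trdeg_eq_zero (R := O) (A := F), zero_add]
    have hfin : Algebra.trdeg O (Γ(T, V) ⧸ qσ.asIdeal) < Cardinal.aleph0 := by
      rw [htr2]; exact trdeg_lt_aleph0
    refine ⟨?_, ?_⟩
    · -- `Q' ∩ 𝒪 = ((𝔭_σ ∩ F) ∩ 𝒪) = 0`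
      have h1 : Q'.under O = Ideal.comap (algebraMap O F) (Ideal.comap χ qσ.asIdeal) := by
        rw [Ideal.under_def, hQ'eq, Ideal.comap_comap, Ideal.comap_comap]
        exact congrArg (fun g => Ideal.comap g qσ.asIdeal) htower
      rw [h1, Ideal.eq_bot_of_prime (Ideal.comap χ qσ.asIdeal),
        Ideal.comap_bot_of_injective _ (IsFractionRing.injective O F)]
    · calc Cardinal.toNat (Algebra.trdeg O (Γ(Y, U) ⧸ Q'))
            ≤ Cardinal.toNat (Algebra.trdeg O (Γ(T, V) ⧸ qσ.asIdeal)) :=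
            Cardinal.toNat_le_toNat htr1 hfin
        _ = Cardinal.toNat (Algebra.trdeg F (Γ(T, V) ⧸ qσ.asIdeal)) := by rw [htr2]
        _ ≤ n := by exact_mod_cast hdimD
  -- assemble
  have hineq := CP2019.height_le_height_under_add_of_trdeg_minimalPrimes (A := O) P.asIdeal n key
  rw [hco]
  calc P.asIdeal.height ≤ (P.asIdeal.under O).height + n := hineq
    _ ≤ d + (n : ℕ∞) := add_le_add_left hhtd _
    _ = (n + d : ℕ) := by rw [add_comm]; norm_cast

/-- **Dimension of a FLAT model from its generic fibre, cartesian-square form**: `𝒪` a Noetherian domain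
with `dim 𝒪 ≤ d` and fraction field `F`, `s : 𝒴 → Spec 𝒪` flat and locally of finite type, and a cartesian
square `j : S → 𝒴`, `σ : S → Spec F` over `Spec F → Spec 𝒪` (generic fibre `𝒴 ×_𝒪 F = S`) with
`dim S ≤ n`. Then `dim 𝒴 ≤ n + d`: a flat morphism is generising (EGA IV₂ (2.3.4), Mathlib
`Flat.generalizingMap`), so every maximal point of `𝒴` lies over the generic point of `Spec 𝒪`, i.e. on the
generic fibre. [cite: EGAIV2, (2.3.4)] [cite: Matsumura1987, Thm. 15.5] -/
theorem topologicalKrullDim_le_of_isPullback_genericFibre_of_ringKrullDim_le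
    {O F : Type u} [CommRing O] [IsDomain O] [IsNoetherianRing O] [Field F] [Algebra O F]
    [IsFractionRing O F] {d : ℕ} (hO : ringKrullDim O ≤ d)
    {Y S : Scheme.{u}} (s : Y ⟶ Spec (.of O)) [LocallyOfFiniteType s] [Flat s]
    (σ : S ⟶ Spec (.of F)) (j : S ⟶ Y)
    (hfib : IsPullback j σ s (Spec.map (CommRingCat.ofHom (algebraMap O F))))
    {n : ℕ} (hS : topologicalKrullDim S ≤ n) : topologicalKrullDim Y ≤ (n + d : ℕ) := by
  -- adapted from CossartPiltant200819/Rem41GenericFibreDimension2019.lean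
  classical
  set i : Spec (.of F) ⟶ Spec (.of O) := Spec.map (CommRingCat.ofHom (algebraMap O F)) with hi
  haveI : LocallyOfFiniteType σ := MorphismProperty.of_isPullback hfib inferInstance
  haveI : IsAffineHom j := MorphismProperty.of_isPullback hfib.flip inferInstance
  refine topologicalKrullDim_le_of_genericFibre_of_isMax_of_ringKrullDim_le hO s σ j hfib.w
    (fun ξ hξ => ?_) hS
  -- `s ξ` is the generic point of `Spec 𝒪`
  have hbot : (s ξ).asIdeal = ⊥ := by
    have hspec : (⟨⊥, Ideal.isPrime_bot⟩ : PrimeSpectrum O) ⤳ s ξ :=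
      (PrimeSpectrum.le_iff_specializes _ _).mp bot_le
    obtain ⟨ξ', hξ'ξ, hsξ'⟩ := Flat.generalizingMap s hspec
    have h1 : ξ ⤳ ξ' := Scheme.le_iff_specializes.mp (hξ (Scheme.le_iff_specializes.mpr hξ'ξ))
    have h2 : s ξ ⤳ s ξ' := h1.map s.continuous
    rw [hsξ'] at h2
    have h3 := (PrimeSpectrum.le_iff_specializes _ _).mpr h2
    exact le_bot_iff.mp ((PrimeSpectrum.asIdeal_le_asIdeal _ _).mpr h3)
  let x₀ : ↥(Spec (CommRingCat.of F)) := (⟨⊥, Ideal.isPrime_bot⟩ : PrimeSpectrum F)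
  have hx₀ : s ξ = i x₀ := by
    rw [hi, CP2019.specMap_algebraMap_apply_eq_bot F x₀]
    exact PrimeSpectrum.ext hbot
  obtain ⟨z, hz, -⟩ := Scheme.exists_preimage_of_isPullback hfib ξ x₀ hx₀
  exact ⟨z, hz⟩

/-- **Dimension of an IRREDUCIBLE model from its generic fibre, cartesian-square form** (no flatness):
`𝒪` a Noetherian domain with `dim 𝒪 ≤ d` and fraction field `F`, `s : 𝒴 → Spec 𝒪` locally of finite
type with `𝒴` irreducible, and a cartesian square `j : S → 𝒴`, `σ : S → Spec F` over `Spec F → Spec 𝒪`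
with `S` NON-EMPTY of dimension `≤ n`. Then `dim 𝒴 ≤ n + d`: the only maximal point of `𝒴` is its generic
point `η`; a point `z ∈ S` gives `j z ∈ 𝒴` over the generic point of `Spec 𝒪`, and `η ⤳ j z` maps to a
specialisation in `Spec 𝒪` ending at the generic point, so `s η` is the generic point too and `η` lies on
the generic fibre. [cite: Matsumura1987, Thm. 15.5] -/
theorem topologicalKrullDim_le_of_isPullback_genericFibre_of_irreducibleSpace
    {O F : Type u} [CommRing O] [IsDomain O] [IsNoetherianRing O] [Field F] [Algebra O F]
    [IsFractionRing O F] {d : ℕ} (hO : ringKrullDim O ≤ d)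
    {Y S : Scheme.{u}} [IrreducibleSpace Y] [Nonempty S] (s : Y ⟶ Spec (.of O)) [LocallyOfFiniteType s]
    (σ : S ⟶ Spec (.of F)) (j : S ⟶ Y)
    (hfib : IsPullback j σ s (Spec.map (CommRingCat.ofHom (algebraMap O F))))
    {n : ℕ} (hS : topologicalKrullDim S ≤ n) : topologicalKrullDim Y ≤ (n + d : ℕ) := by
  classical
  set i : Spec (.of F) ⟶ Spec (.of O) := Spec.map (CommRingCat.ofHom (algebraMap O F)) with hi
  haveI : LocallyOfFiniteType σ := MorphismProperty.of_isPullback hfib inferInstance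
  haveI : IsAffineHom j := MorphismProperty.of_isPullback hfib.flip inferInstance
  refine topologicalKrullDim_le_of_genericFibre_of_isMax_of_ringKrullDim_le hO s σ j hfib.w
    (fun ξ hξ => ?_) hS
  let x₀ : ↥(Spec (CommRingCat.of F)) := (⟨⊥, Ideal.isPrime_bot⟩ : PrimeSpectrum F)
  -- `ξ` is the generic point `η` of `Y`
  obtain ⟨z⟩ := (inferInstance : Nonempty S)
  have hη : genericPoint Y ⤳ ξ := genericPoint_specializes ξ
  have hξη : ξ = genericPoint Y := by
    have h1 : ξ ⤳ genericPoint Y :=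
      Scheme.le_iff_specializes.mp (hξ (Scheme.le_iff_specializes.mpr hη))
    exact (h1.antisymm hη).eq
  -- `s (j z)` is the generic point of `Spec 𝒪`, and `η ⤳ j z`
  have hjz : s (j z) = i x₀ := by
    rw [← Scheme.Hom.comp_apply, hfib.w, Scheme.Hom.comp_apply, hi,
      CP2019.specMap_algebraMap_apply_eq_bot F (σ z), CP2019.specMap_algebraMap_apply_eq_bot F x₀]
  have hbot : (s ξ).asIdeal = ⊥ := by
    have h1 : s ξ ⤳ s (j z) := by
      rw [hξη]
      exact (genericPoint_specializes (j z)).map s.continuous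
    rw [hjz, hi, CP2019.specMap_algebraMap_apply_eq_bot F x₀] at h1
    have h3 := (PrimeSpectrum.le_iff_specializes _ _).mpr h1
    exact le_bot_iff.mp ((PrimeSpectrum.asIdeal_le_asIdeal _ _).mpr h3)
  have hx₀ : s ξ = i x₀ := by
    rw [hi, CP2019.specMap_algebraMap_apply_eq_bot F x₀]
    exact PrimeSpectrum.ext hbot
  obtain ⟨w, hw, -⟩ := Scheme.exists_preimage_of_isPullback hfib ξ x₀ hx₀
  exact ⟨w, hw⟩

end Literature.AlgebraicGeometry.Dimension

end
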